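import Summits.Langlands.Langlands.Theses.ParityBlindBianchi
import Literature.NumberTheory.Automorphic.BaseChangeGLnProofs

/-!
# `QuadraticDescentGL2` (stmt-Langlands-16811): load-bearing analysis of its hypotheses (def-free form)

Negative-side lemmas (crux disprover `cdisprove-stmt-Langlands-16811`, cycle 1, 2026-08-17;
supports stmt-Langlands-16811). The crux (route `ParityBlindBianchi`, rank 4, promoted theorem in
print: Langlands 1980 / Arthur–Clozel Ch. 3 Thm 4.2 (d) at `n = 2`) reads: for `E/F` a quadratic
Galois extension of number fields and a cuspidal datum `P` on `GL₂(𝔸_E)` with Galois-stable Satake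
data a.e., some cuspidal `π` on `GL₂(𝔸_F)` has `P` as a weak base-change lift. All dropped-hypothesis
variants are INLINED (no `def : Prop`), so this file introduces no named fact.

* `quadraticDescentGL2_iff_dropIsGalois` — the instance binder `[IsGalois F E]` is NOT
  load-bearing: it follows from `Module.finrank F E = 2` in characteristic `0`
  (`isGalois_of_finrank_eq_two`, Mathlib `IsQuadraticExtension.isGalois`).
* `galoisStable_of_weakLift`, `quadraticDescentGL2_iff_image` — the hypothesis
  `IsGaloisStableSatakeAE F P.1` IS load-bearing and sharp: it is implied by the conclusion (tree
  theorem `IsWeakBaseChangeLiftAE.isGaloisStableSatakeAE'`, Arthur–Clozel Ch. 3 Prop. 4.4 (i), over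
  the Flath theorems `hasSatakeParamAt_cofinite_holds` / `_unique_holds`), so the crux is exactly
  the `⟹` half of "Galois-stable ⟺ weak quadratic base change of a cuspidal `π`".
* `not_dropStability_of_exists_nonStable` — the crux with the stability hypothesis dropped is
  false as soon as ONE cuspidal datum with non-stable Satake data exists (in print any
  `BC(π) ⊗ μ` with `μ ≠ μ ∘ σ`; not constructible in the tree, which has no inhabitant of
  `CuspidalAutomorphicRepData`).

No statement of the route is asserted positively. Work file with the full drift audit:
`Cruxes/QuadraticDescentGL2/Disproof.lean`.
-/

set_option linter.dupNamespace false -- `Summit.Langlands.Langlands` is the mandated namespace (D-0017)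

namespace Summit.Langlands.Langlands.Theorems.QuadraticDescentGL2.Negative

open Literature.NumberTheory.Automorphic
open Summit.Langlands.Langlands.Theses.ParityBlindBianchi (QuadraticDescentGL2)

/-- A quadratic extension of number fields is Galois (degree `2`, characteristic `0`: separable
because `F` is perfect, normal because quadratic; Mathlib `IsQuadraticExtension.isGalois`). [folklore] -/
theorem isGalois_of_finrank_eq_two (F E : Type) [Field F] [NumberField F] [Field E] [NumberField E]
    [Algebra F E] (h2 : Module.finrank F E = 2) : IsGalois F E := by
  haveI : Algebra.IsQuadraticExtension F E := ⟨h2⟩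
  haveI : FiniteDimensional F E := Module.finite_of_finrank_pos (by omega)
  infer_instance

/-- `[IsGalois F E]` is not load-bearing: the crux is equivalent to the same statement with the
instance binder dropped (`isGalois_of_finrank_eq_two`). [folklore] -/
theorem quadraticDescentGL2_iff_dropIsGalois :
    QuadraticDescentGL2 ↔
      ∀ (F E : Type) [Field F] [NumberField F] [Field E] [NumberField E] [Algebra F E],
        Module.finrank F E = 2 →
          ∀ (hF : isCompact_glFiniteIntegralLevel 2 F) (hE : isCompact_glFiniteIntegralLevel 2 E)
            (P : CuspidalAutomorphicRepData 2 E hE), IsGaloisStableSatakeAE F P.1 →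
              ∃ π : CuspidalAutomorphicRepData 2 F hF, IsWeakBaseChangeLiftAE π.1 P.1 := by
  constructor
  · intro h F E _ _ _ _ _ h2 hF hE P hP
    haveI := isGalois_of_finrank_eq_two F E h2
    exact h F E h2 hF hE P hP
  · intro h F E _ _ _ _ _ _ h2 hF hE P hP
    exact h F E h2 hF hE P hP

/-- **Necessity of the hypothesis.** A cuspidal datum on `GL₂(𝔸_E)` that is a weak base-change
lift of a cuspidal datum on `GL₂(𝔸_F)`, `E/F` Galois, has Galois-stable Satake data (tree theorem
`IsWeakBaseChangeLiftAE.isGaloisStableSatakeAE'`, Arthur–Clozel Ch. 3 Prop. 4.4 (i), over the Flath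
theorems). [cite: ArthurClozelAMS120, Ch. 3, Prop. 4.4 (i)] -/
theorem galoisStable_of_weakLift (F E : Type) [Field F] [NumberField F] [Field E] [NumberField E]
    [Algebra F E] [IsGalois F E] {hF : isCompact_glFiniteIntegralLevel 2 F}
    {hE : isCompact_glFiniteIntegralLevel 2 E} (π : CuspidalAutomorphicRepData 2 F hF)
    (P : CuspidalAutomorphicRepData 2 E hE) (h : IsWeakBaseChangeLiftAE π.1 P.1) :
    IsGaloisStableSatakeAE F P.1 :=
  h.isGaloisStableSatakeAE'

/-- **The crux is the `⟹` half of an `iff`.** `QuadraticDescentGL2` is equivalent to: for `E/F`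
quadratic Galois and `P` a cuspidal datum on `GL₂(𝔸_E)`, `P` has Galois-stable Satake data iff it
is a weak base-change lift of some cuspidal datum on `GL₂(𝔸_F)` (the `⟸` half being
`galoisStable_of_weakLift`). [folklore] -/
theorem quadraticDescentGL2_iff_image :
    QuadraticDescentGL2 ↔
      ∀ (F E : Type) [Field F] [NumberField F] [Field E] [NumberField E] [Algebra F E]
        [IsGalois F E], Module.finrank F E = 2 →
          ∀ (hF : isCompact_glFiniteIntegralLevel 2 F) (hE : isCompact_glFiniteIntegralLevel 2 E)
            (P : CuspidalAutomorphicRepData 2 E hE),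
              IsGaloisStableSatakeAE F P.1 ↔
                ∃ π : CuspidalAutomorphicRepData 2 F hF, IsWeakBaseChangeLiftAE π.1 P.1 := by
  constructor
  · intro h F E _ _ _ _ _ _ h2 hF hE P
    exact ⟨h F E h2 hF hE P, fun ⟨π, hπ⟩ => galoisStable_of_weakLift F E π P hπ⟩
  · intro h F E _ _ _ _ _ _ h2 hF hE P hP
    exact (h F E h2 hF hE P).1 hP

/-- **`_false_without_` Galois-stability (modulo one inhabitant).** Any proof of the crux must use
`IsGaloisStableSatakeAE F P.1`: the crux with that hypothesis dropped contradicts the existence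
of a single cuspidal datum on `GL₂` over a quadratic extension with non-stable Satake data
(`galoisStable_of_weakLift`). [folklore] -/
theorem not_dropStability_of_exists_nonStable
    (H : ∃ (F E : Type) (_ : Field F) (_ : NumberField F) (_ : Field E) (_ : NumberField E)
      (_ : Algebra F E) (_ : IsGalois F E) (_ : Module.finrank F E = 2)
      (_ : isCompact_glFiniteIntegralLevel 2 F) (hE : isCompact_glFiniteIntegralLevel 2 E)
      (P : CuspidalAutomorphicRepData 2 E hE), ¬ IsGaloisStableSatakeAE F P.1) :
    ¬ ∀ (F E : Type) [Field F] [NumberField F] [Field E] [NumberField E] [Algebra F E]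
        [IsGalois F E], Module.finrank F E = 2 →
          ∀ (hF : isCompact_glFiniteIntegralLevel 2 F) (hE : isCompact_glFiniteIntegralLevel 2 E)
            (P : CuspidalAutomorphicRepData 2 E hE),
              ∃ π : CuspidalAutomorphicRepData 2 F hF, IsWeakBaseChangeLiftAE π.1 P.1 := by
  intro h
  obtain ⟨F, E, _, _, _, _, _, _, h2, hF, hE, P, hP⟩ := H
  obtain ⟨π, hπ⟩ := h F E h2 hF hE P
  exact hP (galoisStable_of_weakLift F E π P hπ)

end Summit.Langlands.Langlands.Theorems.QuadraticDescentGL2.Negative
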